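import Mathlib
import HarnessLib

/-!
# courier split of the staged transcript `OSWMechanismConvexCone.lean` — part 01 of 01

1-D model (gCLM/OSW), computer-assisted; not Euler/NS.  Filed under `Summits/NavierStokesRegularity/OSWSelfSimilar/` by a prover-role courier on behalf of the
mechanism seat pub-oswblow-mech (planner-pub-oswblow-mech-g30-0), cell pub-oswblow (host summit NavierStokesRegularity); the gate admits the path but
not role planner.  CONTENT = the staged transcript `pub-oswblow-mech/lean/OSWMechanismConvexCone.lean` (sha256 242f9b63e37255c9…,
332 lines), source lines 27–332, UNCHANGED except: (i) namespace prefix `OSWSelfSimilar.Mechanism` → `Summit.NavierStokesRegularity.OSWSelfSimilar.Mechanism`;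
(ii) [parts >= 02 only: the frames open at the cut are re-opened above the body and closed at the end; nothing to re-open here]
(iii) this docstring and, below it, the transcript's own module documentation VERBATIM (renamed).  Generated by `pub-oswblow-mech/lean/courier/make_split.py`; the parts must be filed IN ORDER
(each imports its predecessor).  First/last declarations here: `four_pm_eq` … `ConeInvariant` (35 in this part).
AI-written transcript; kernel-checked on the farm as ONE file before splitting (see the kit's CHECKS); to be checked, not trusted.
COURIER NOTE (prover-role courier seat pub-oswblow-courier g2, 2026-08-25): in addition to the changes listed above, 13 one-line docstrings were added at filing on the declarations the transcript left undocumented (tree docstring rule); each only restates the formal statement of its declaration; nothing else was touched. List of the added docstrings: HOME `pub-oswblow-courier/g2/DOCSTRINGS.tsv`.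
-/

/-!
# OSW mechanism — the periodic HQWW cone: convexity in `cos x` is preserved (MECHANISM §35.10–35.13, v30b)

**1-D model (gCLM/OSW), computer-assisted; not Euler/NS.**  Standalone companion file (imports Mathlib only;
namespace `Summit.NavierStokesRegularity.OSWSelfSimilar.Mechanism.ConvexCone`); cell `pub-oswblow`, seat `pub-oswblow-mech`, gen 30 (v30b).
STAGED in the cell HOME, not filed in the tree (needs-human 46559/46558).  NO axiom, NO sorry.

KERNEL-CHECKED here (checks (241)–(244) of MECHANISM §35.13):
* (241) the identities behind LEMMA 35.9: `4·sin²((x+t)/2)·sin²((x−t)/2) = (cos x − cos t)²` (`four_pm_eq`),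
  `(1 − cos x cos t)² = (cos x − cos t)² + (sin x sin t)²` (`K_sq`), the substitution form of `r·𝔐′(r)`
  (`rMprime_form`) and the numerator identity (35.13) (`e_numerator`);
* (242) the Möbius quotient `α ↦ (K + 2αP)/(P + 2αK)` is antitone for `0 < P < K` (`moebius_numerator`,
  `moebius_anti`);
* (243) the one-variable inequality (35.14): `½·log((1+sin ϑ)/(1−sin ϑ)) < tan ϑ·(1+2cos ϑ)/(2+cos ϑ)` on
  `(0, π/2)` (`artanh_sin_lt`), through `HasDerivAt` computations, the numerator identity `J_deriv_numerator`
  and strict monotonicity (`Jfun_strictMonoOn`);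
* (244) `log r < (r − r⁻¹)/2` for `r > 1` (`log_lt_half_sub_inv`; the geometric–logarithmic mean side), hence the
  numerator `r² − 1 − 2r·log r` of `𝔐′(r)` is positive (`Mderiv_numerator_pos`).
TYPED, NOT PROVED (statements as `Prop`s over abstract data; docstrings say so): `KernelIneq` (LEMMA 35.9 for the
concrete kernel), `ConvexInCosPreserved` (THEOREM 35.8 = THEOREM M43) and `ConeInvariant` (COROLLARY 35.10) over an
abstract linear map `u ↦ G[u]` — the operator `G[u] = |∂|⁻¹(u·sin)/sin` itself, the total-mass identity (35.11) and
the reflection argument are not formalised.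
-/

noncomputable section

open Set Real

namespace Summit.NavierStokesRegularity.OSWSelfSimilar.Mechanism.ConvexCone

/-! ### (241) Identities behind LEMMA 35.9 -/

/-- `4pm = P²`: `4·sin²((x+t)/2)·sin²((x−t)/2) = (cos x − cos t)²`. -/
theorem four_pm_eq (x t : ℝ) :
    4 * Real.sin ((x + t) / 2) ^ 2 * Real.sin ((x - t) / 2) ^ 2 = (Real.cos x - Real.cos t) ^ 2 := by
  rw [Real.cos_sub_cos]
  ring

/-- `K² = P² + S²`: `(1 − cos x cos t)² = (cos x − cos t)² + (sin x sin t)²`, from `sin² + cos² = 1` twice. -/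
theorem K_sq (sx cx st ct : ℝ) (hx : sx ^ 2 + cx ^ 2 = 1) (ht : st ^ 2 + ct ^ 2 = 1) :
    (1 - cx * ct) ^ 2 = (cx - ct) ^ 2 + (sx * st) ^ 2 := by
  linear_combination (-st ^ 2) * hx + (-(1 - cx ^ 2)) * ht

/-- `(1 − cos x cos t)² = (cos x − cos t)² + (sin x sin t)²`. -/
theorem K_sq_trig (x t : ℝ) :
    (1 - Real.cos x * Real.cos t) ^ 2
      = (Real.cos x - Real.cos t) ^ 2 + (Real.sin x * Real.sin t) ^ 2 :=
  K_sq _ _ _ _ (Real.sin_sq_add_cos_sq x) (Real.sin_sq_add_cos_sq t)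

/-- The substitution form of `r·𝔐′(r) = −r·log r/(r−1)² + (r+1)/(2(r−1))`: with `log r = 2Λ`,
`r/(r−1)² = P²/(4S²)` and `(r+1)/(r−1) = K/S` it equals `(K·S − Λ·P²)/(2S²)`. -/
theorem rMprime_form (K S P Λ : ℝ) (hS : S ≠ 0) :
    -(2 * Λ) * (P ^ 2 / (4 * S ^ 2)) + (K / S) / 2 = (K * S - Λ * P ^ 2) / (2 * S ^ 2) := by
  field_simp
  ring

/-- (35.13): clearing the denominator `2S²P·sin x` in `e = r𝔐′·sin t/P − 𝔐·cos x/sin x` with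
`r𝔐′ = (KS − ΛP²)/(2S²)`, `𝔐 = (KΛ − S)/S`, `S = sin x·sin t`, `α = cos x`. -/
theorem e_numerator (K S P Λ α : ℝ) :
    (K * S - Λ * P ^ 2) * S - 2 * α * S * P * (K * Λ - S)
      = S * (S * (K + 2 * α * P) - Λ * P * (P + 2 * α * K)) := by
  ring

/-- The full bookkeeping of (35.13) as one rational identity: for `S = sx·st ≠ 0`, `P ≠ 0`, `sx ≠ 0`,
`((KS − ΛP²)/(2S²))·st/P − ((KΛ − S)/S)·(α/sx) = (S(K+2αP) − ΛP(P+2αK))/(2·S·P·sx)`. -/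
theorem e_form (K P Λ α sx st : ℝ) (hsx : sx ≠ 0) (hst : st ≠ 0) (hP : P ≠ 0) :
    (K * (sx * st) - Λ * P ^ 2) / (2 * (sx * st) ^ 2) * st / P - (K * Λ - sx * st) / (sx * st) * (α / sx)
      = ((sx * st) * (K + 2 * α * P) - Λ * P * (P + 2 * α * K)) / (2 * (sx * st) * P * sx) := by
  field_simp
  ring

/-! ### (242) The Möbius quotient is antitone in `α` -/

/-- Numerator algebra: `2P(P + 2αK) − 2K(K + 2αP) = −2(K² − P²)`. -/
theorem moebius_numerator (P K α : ℝ) :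
    2 * P * (P + 2 * α * K) - 2 * K * (K + 2 * α * P) = -2 * (K ^ 2 - P ^ 2) := by
  ring

/-- For `0 < P < K` the map `α ↦ (K + 2αP)/(P + 2αK)` is antitone on `[0, ∞)`; in particular
`Ω(α) ≥ Ω(1)` for `α ∈ [0,1]` (LEMMA 35.9, MONOTONICITY IN α). -/
theorem moebius_anti (P K α β : ℝ) (hP : 0 < P) (hPK : P < K) (hα : 0 ≤ α) (hαβ : α ≤ β) :
    (K + 2 * β * P) / (P + 2 * β * K) ≤ (K + 2 * α * P) / (P + 2 * α * K) := by
  have hK : 0 < K := lt_trans hP hPK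
  have hβ : 0 ≤ β := le_trans hα hαβ
  have d1 : 0 < P + 2 * β * K := by positivity
  have d2 : 0 < P + 2 * α * K := by positivity
  have key : (K + 2 * α * P) / (P + 2 * α * K) - (K + 2 * β * P) / (P + 2 * β * K)
      = 2 * (β - α) * (K ^ 2 - P ^ 2) / ((P + 2 * α * K) * (P + 2 * β * K)) := by
    field_simp
    ring
  have hnum : 0 ≤ 2 * (β - α) * (K ^ 2 - P ^ 2) := by
    apply mul_nonneg
    · linarith
    · nlinarith
  have hfrac : 0 ≤ 2 * (β - α) * (K ^ 2 - P ^ 2) / ((P + 2 * α * K) * (P + 2 * β * K)) :=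
    div_nonneg hnum (le_of_lt (mul_pos d2 d1))
  linarith [key, hfrac]

/-! ### (243) The one-variable inequality (35.14) -/

/-- Numerator algebra for `J′`: `(1 + 2C)(2 + C) − 3(1 − C²)C − C(2 + C)² = 2(1 − C)²(1 + C)`. -/
theorem J_deriv_numerator (C : ℝ) :
    (1 + 2 * C) * (2 + C) - 3 * (1 - C ^ 2) * C - C * (2 + C) ^ 2 = 2 * (1 - C) ^ 2 * (1 + C) := by
  ring

/-- `J(ϑ) = tan ϑ·(1+2cos ϑ)/(2+cos ϑ) − ½·log((1+sin ϑ)/(1−sin ϑ))` (`= Ω₁ − artanh(sin ϑ)`). -/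
def Jfun (θ : ℝ) : ℝ :=
  Real.tan θ * (1 + 2 * Real.cos θ) / (2 + Real.cos θ)
    - (1 / 2) * Real.log ((1 + Real.sin θ) / (1 - Real.sin θ))

/-- `J(0) = 0`. -/
theorem Jfun_zero : Jfun 0 = 0 := by
  simp [Jfun]

/-- On `[0, π/2)`: `cos ϑ > 0`, `sin ϑ < 1`, `−1 < sin ϑ`. -/
theorem cos_pos_of_mem (θ : ℝ) (h0 : 0 ≤ θ) (h1 : θ < Real.pi / 2) : 0 < Real.cos θ := by
  apply Real.cos_pos_of_mem_Ioo
  constructor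
  · have := Real.pi_pos
    linarith
  · exact h1

/-- `sin ϑ < 1` for `0 ≤ ϑ < π/2`. -/
theorem sin_lt_one_of_mem (θ : ℝ) (h0 : 0 ≤ θ) (h1 : θ < Real.pi / 2) : Real.sin θ < 1 := by
  have hc := cos_pos_of_mem θ h0 h1
  nlinarith [Real.sin_sq_add_cos_sq θ, Real.sin_le_one θ]

/-- `−1 < sin ϑ` for `0 ≤ ϑ < π/2`. -/
theorem neg_one_lt_sin_of_mem (θ : ℝ) (h0 : 0 ≤ θ) (h1 : θ < Real.pi / 2) : -1 < Real.sin θ := by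
  have hc := cos_pos_of_mem θ h0 h1
  nlinarith [Real.sin_sq_add_cos_sq θ, Real.neg_one_le_sin θ]

/-- The derivative of `J` on `[0, π/2)`:
`J′(ϑ) = ((1+2c)(2+c) − 3s²c)/(c²(2+c)²) − c/((1−s)(1+s))` with `c = cos ϑ`, `s = sin ϑ`. -/
theorem Jfun_hasDerivAt (θ : ℝ) (h0 : 0 ≤ θ) (h1 : θ < Real.pi / 2) :
    HasDerivAt Jfun
      (((1 + 2 * Real.cos θ) * (2 + Real.cos θ) - 3 * Real.sin θ ^ 2 * Real.cos θ)
          / (Real.cos θ ^ 2 * (2 + Real.cos θ) ^ 2)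
        - Real.cos θ / ((1 - Real.sin θ) * (1 + Real.sin θ))) θ := by
  have hc : Real.cos θ ≠ 0 := ne_of_gt (cos_pos_of_mem θ h0 h1)
  have hs1 : 1 - Real.sin θ ≠ 0 := by
    have := sin_lt_one_of_mem θ h0 h1
    intro h; linarith
  have hs2 : 1 + Real.sin θ ≠ 0 := by
    have := neg_one_lt_sin_of_mem θ h0 h1
    intro h; linarith
  have h2c : 2 + Real.cos θ ≠ 0 := by
    have := Real.neg_one_le_cos θ
    intro h; linarith
  -- first summand: tan θ * (1 + 2 cos θ) / (2 + cos θ)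
  have ht : HasDerivAt Real.tan (1 / Real.cos θ ^ 2) θ := Real.hasDerivAt_tan hc
  have hcos : HasDerivAt Real.cos (-Real.sin θ) θ := Real.hasDerivAt_cos θ
  have hsin : HasDerivAt Real.sin (Real.cos θ) θ := Real.hasDerivAt_sin θ
  have hnum : HasDerivAt (fun s => Real.tan s * (1 + 2 * Real.cos s))
      (1 / Real.cos θ ^ 2 * (1 + 2 * Real.cos θ) + Real.tan θ * (2 * -Real.sin θ)) θ :=
    ht.fun_mul ((hcos.const_mul 2).const_add 1)
  have hden : HasDerivAt (fun s => 2 + Real.cos s) (-Real.sin θ) θ := hcos.const_add 2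
  have hA := hnum.fun_div hden h2c
  -- second summand: (1/2) log((1 + sin)/(1 - sin))
  have hinner : HasDerivAt (fun s => (1 + Real.sin s) / (1 - Real.sin s))
      ((Real.cos θ * (1 - Real.sin θ) - (1 + Real.sin θ) * (-Real.cos θ)) / (1 - Real.sin θ) ^ 2) θ :=
    (hsin.const_add 1).fun_div (hsin.const_sub 1) hs1
  have hpos : (1 + Real.sin θ) / (1 - Real.sin θ) ≠ 0 := div_ne_zero hs2 hs1
  have hlog := (hinner.log hpos).const_mul (1 / 2 : ℝ)
  have hJ := hA.sub hlog
  have e1 : Jfun = fun s => Real.tan s * (1 + 2 * Real.cos s) / (2 + Real.cos s)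
      - (1 / 2) * Real.log ((1 + Real.sin s) / (1 - Real.sin s)) := by
    funext s; rfl
  rw [e1]
  apply hJ.congr_deriv
  rw [Real.tan_eq_sin_div_cos]
  field_simp
  ring

/-- The derivative is `2(1 − cos ϑ)²(1 + cos ϑ)/(cos²ϑ(2 + cos ϑ)²)` (uses `sin² = 1 − cos²`). -/
theorem Jfun_deriv_eq (θ : ℝ) (h0 : 0 ≤ θ) (h1 : θ < Real.pi / 2) :
    deriv Jfun θ
      = 2 * (1 - Real.cos θ) ^ 2 * (1 + Real.cos θ) / (Real.cos θ ^ 2 * (2 + Real.cos θ) ^ 2) := by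
  rw [(Jfun_hasDerivAt θ h0 h1).deriv]
  have hc : Real.cos θ ≠ 0 := ne_of_gt (cos_pos_of_mem θ h0 h1)
  have hs1 : 1 - Real.sin θ ≠ 0 := by
    have := sin_lt_one_of_mem θ h0 h1
    intro h; linarith
  have hs2 : 1 + Real.sin θ ≠ 0 := by
    have := neg_one_lt_sin_of_mem θ h0 h1
    intro h; linarith
  have h2c : 2 + Real.cos θ ≠ 0 := by
    have := Real.neg_one_le_cos θ
    intro h; linarith
  have hpy : (1 - Real.sin θ) * (1 + Real.sin θ) = Real.cos θ ^ 2 := by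
    nlinarith [Real.sin_sq_add_cos_sq θ]
  have hss : Real.sin θ ^ 2 = 1 - Real.cos θ ^ 2 := by
    nlinarith [Real.sin_sq_add_cos_sq θ]
  rw [hpy, hss]
  field_simp
  ring

/-- `0 < J′(ϑ)` for `0 < ϑ < π/2`. -/
theorem Jfun_deriv_pos (θ : ℝ) (h0 : 0 < θ) (h1 : θ < Real.pi / 2) : 0 < deriv Jfun θ := by
  rw [Jfun_deriv_eq θ (le_of_lt h0) h1]
  have hc := cos_pos_of_mem θ (le_of_lt h0) h1
  have hc1 : Real.cos θ < 1 := by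
    -- cos θ = 1 with θ ∈ (0, π/2) is impossible: cos is strictly antitone on [0, π]
    have hlt : Real.cos θ < Real.cos 0 := by
      apply Real.cos_lt_cos_of_nonneg_of_le_pi_div_two (le_refl 0) (le_of_lt h1) h0
    simpa using hlt
  have hnum : 0 < 2 * (1 - Real.cos θ) ^ 2 * (1 + Real.cos θ) := by
    have h1c : 0 < 1 - Real.cos θ := by linarith
    positivity
  have hden : 0 < Real.cos θ ^ 2 * (2 + Real.cos θ) ^ 2 := by positivity
  exact div_pos hnum hden

/-- `J` is continuous on `[0, π/2)`. -/
theorem Jfun_continuousOn : ContinuousOn Jfun (Ico 0 (Real.pi / 2)) := by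
  intro θ hθ
  exact (Jfun_hasDerivAt θ hθ.1 hθ.2).continuousAt.continuousWithinAt

/-- `J` is strictly increasing on `[0, π/2)`. -/
theorem Jfun_strictMonoOn : StrictMonoOn Jfun (Ico 0 (Real.pi / 2)) := by
  apply strictMonoOn_of_deriv_pos (convex_Ico 0 (Real.pi / 2)) Jfun_continuousOn
  intro θ hθ
  rw [interior_Ico] at hθ
  exact Jfun_deriv_pos θ hθ.1 hθ.2

/-- (243) = (35.14): `artanh(sin ϑ) < tan ϑ·(1 + 2cos ϑ)/(2 + cos ϑ)` for `0 < ϑ < π/2`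
(`artanh(sin ϑ) = ½·log((1+sin ϑ)/(1−sin ϑ))`). -/
theorem artanh_sin_lt (θ : ℝ) (h0 : 0 < θ) (h1 : θ < Real.pi / 2) :
    (1 / 2) * Real.log ((1 + Real.sin θ) / (1 - Real.sin θ))
      < Real.tan θ * (1 + 2 * Real.cos θ) / (2 + Real.cos θ) := by
  have hm : (0:ℝ) ∈ Ico 0 (Real.pi / 2) := ⟨le_refl 0, by have := Real.pi_pos; linarith⟩
  have hθ : θ ∈ Ico 0 (Real.pi / 2) := ⟨le_of_lt h0, h1⟩
  have h := Jfun_strictMonoOn hm hθ h0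
  rw [Jfun_zero] at h
  unfold Jfun at h
  linarith

/-! ### (244) `log r < (r − r⁻¹)/2` for `r > 1`; the numerator of `𝔐′` is positive -/

/-- `ψ(r) = (r − r⁻¹)/2 − log r`. -/
def psi (r : ℝ) : ℝ := (r - r⁻¹) / 2 - Real.log r

/-- For `r > 0`, `ψ(r) = (r − r⁻¹)/2 − log r` has derivative `(1 + r⁻²)/2 − 1/r` at `r`. -/
theorem psi_hasDerivAt (r : ℝ) (hr : 0 < r) :
    HasDerivAt psi ((1 + (r ^ 2)⁻¹) / 2 - 1 / r) r := by
  have hr0 : r ≠ 0 := ne_of_gt hr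
  have h1 : HasDerivAt (fun s : ℝ => s⁻¹) (-(r ^ 2)⁻¹) r := hasDerivAt_inv hr0
  have h2 : HasDerivAt (fun s : ℝ => (s - s⁻¹) / 2) ((1 - -(r ^ 2)⁻¹) / 2) r :=
    ((hasDerivAt_id' r).sub h1).div_const 2
  have h3 : HasDerivAt (fun s : ℝ => Real.log s) (1 / r) r := by
    have := Real.hasDerivAt_log hr0
    simpa [one_div] using this
  have h4 := h2.sub h3
  have e1 : psi = fun s : ℝ => (s - s⁻¹) / 2 - Real.log s := by
    funext s; rfl
  rw [e1]
  apply h4.congr_deriv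
  ring

/-- `0 < ψ′(r)` for `r > 1`. -/
theorem psi_deriv_pos (r : ℝ) (hr : 1 < r) : 0 < deriv psi r := by
  have hr0 : 0 < r := by linarith
  rw [(psi_hasDerivAt r hr0).deriv]
  have key : (1 + (r ^ 2)⁻¹) / 2 - 1 / r = (r - 1) ^ 2 / (2 * r ^ 2) := by
    field_simp
    ring
  rw [key]
  have : 0 < r - 1 := by linarith
  positivity

/-- `ψ` is continuous on `[1, ∞)`. -/
theorem psi_continuousOn : ContinuousOn psi (Ici 1) := by
  intro r hr
  have hr0 : 0 < r := lt_of_lt_of_le one_pos hr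
  exact (psi_hasDerivAt r hr0).continuousAt.continuousWithinAt

/-- `ψ` is strictly increasing on `[1, ∞)`. -/
theorem psi_strictMonoOn : StrictMonoOn psi (Ici 1) := by
  apply strictMonoOn_of_deriv_pos (convex_Ici 1) psi_continuousOn
  intro r hr
  rw [interior_Ici] at hr
  exact psi_deriv_pos r hr

/-- (244) `log r < (r − r⁻¹)/2` for `r > 1` (implied by the geometric–logarithmic mean inequality
`√r < (r−1)/log r`; [Bullen, 'Logarithmic Mean Inequalities' (1)]). -/
theorem log_lt_half_sub_inv (r : ℝ) (hr : 1 < r) : Real.log r < (r - r⁻¹) / 2 := by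
  have h := psi_strictMonoOn (self_mem_Ici : (1 : ℝ) ∈ Ici 1) (le_of_lt hr : (1 : ℝ) ≤ r) hr
  simp only [psi, inv_one, sub_self, zero_div, Real.log_one] at h
  linarith

/-- (244) The numerator of `𝔐′(r) = (r² − 1 − 2r·log r)/(2r(r−1)²)` is positive for `r > 1`,
so `𝔐` is strictly increasing on `(1, ∞)`. -/
theorem Mderiv_numerator_pos (r : ℝ) (hr : 1 < r) : 0 < r ^ 2 - 1 - 2 * r * Real.log r := by
  have h := log_lt_half_sub_inv r hr
  have hr0 : 0 < r := by linarith
  have hr1 : r ≠ 0 := ne_of_gt hr0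
  have e : 2 * r * ((r - r⁻¹) / 2) = r ^ 2 - 1 := by
    have hri : r * r⁻¹ = 1 := mul_inv_cancel₀ hr1
    calc 2 * r * ((r - r⁻¹) / 2) = r * r - r * r⁻¹ := by ring
      _ = r ^ 2 - 1 := by rw [hri]; ring
  have h2 : 2 * r * Real.log r < 2 * r * ((r - r⁻¹) / 2) := by
    apply mul_lt_mul_of_pos_left h
    positivity
  linarith

/-! ### Typed statements (NOT proved here; no axiom, no sorry) -/

/-- The kernel sign function `𝔐(r) = ((r+1)/(2(r−1)))·log r − 1` of LEMMA 35.1 (as in the v30 companion). -/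
def Mfun (r : ℝ) : ℝ := (r + 1) / (2 * (r - 1)) * Real.log r - 1

/-- `r·𝔐′(r) = −r·log r/(r−1)² + (r+1)/(2(r−1))`. -/
def rMprime (r : ℝ) : ℝ := -(r * Real.log r) / (r - 1) ^ 2 + (r + 1) / (2 * (r - 1))

/-- The conformal ratio `r(x,t) = sin²((x+t)/2)/sin²((x−t)/2)`. -/
def rr (x t : ℝ) : ℝ := Real.sin ((x + t) / 2) ^ 2 / Real.sin ((x - t) / 2) ^ 2

/-- The kernel derivative density `e(x,t) = r𝔐′(r)·sin t/(cos x − cos t) − 𝔐(r)·cot x` of (35.12). -/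
def eKer (x t : ℝ) : ℝ :=
  rMprime (rr x t) * Real.sin t / (Real.cos x - Real.cos t) - Mfun (rr x t) * (Real.cos x / Real.sin x)

/-- LEMMA 35.9 (typed): `e(x,t) > 0` for `0 < x ≤ π/2 < …`, precisely for `0 < x ≤ π/2`, `x < t < π`.  Its proof in
MECHANISM §35.11 = the identities `four_pm_eq`, `K_sq_trig`, `rMprime_form`, `e_form` + `moebius_anti` +
`artanh_sin_lt`, after the identification `sin x sin t/(1 − cos x cos t) = sin ϑ` (not formalised). -/
def KernelIneq : Prop :=
  ∀ x t : ℝ, 0 < x → x ≤ Real.pi / 2 → x < t → t < Real.pi → 0 < eKer x t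

/-- Convexity in the coordinate `c = 1 − cos x` on `(0,π)`: `c ↦ φ(arccos(1 − c))` is convex on `(0,2)`. -/
def ConvexInCos (φ : ℝ → ℝ) : Prop :=
  ConvexOn ℝ (Ioo 0 2) (fun c => φ (Real.arccos (1 - c)))

/-- THEOREM 35.8 = THEOREM M43 (typed, over an abstract map `u ↦ G[u]`; in MECHANISM `G[u] = |∂|⁻¹(u·sin)/sin`):
`u ∈ C([0,π])` convex in `cos x` ⟹ `G[u]` convex in `cos x`. -/
def ConvexInCosPreserved (G : (ℝ → ℝ) → (ℝ → ℝ)) : Prop :=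
  ∀ u : ℝ → ℝ, ContinuousOn u (Icc 0 Real.pi) → ConvexInCos u → ConvexInCos (G u)

/-- COROLLARY 35.10 (typed): the cone `𝒞 = {u ∈ C[0,π] : u non-increasing, convex in cos x}` is mapped into
itself by `u ↦ G[u]`. -/
def ConeInvariant (G : (ℝ → ℝ) → (ℝ → ℝ)) : Prop :=
  ∀ u : ℝ → ℝ, ContinuousOn u (Icc 0 Real.pi) → AntitoneOn u (Icc 0 Real.pi) → ConvexInCos u →
    AntitoneOn (G u) (Ioo 0 Real.pi) ∧ ConvexInCos (G u)

end Summit.NavierStokesRegularity.OSWSelfSimilar.Mechanism.ConvexCone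

end
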